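import Literature.Computability.AlgebraicComplexity.MignonRessayreBound
import Literature.Computability.AlgebraicComplexity.OrbitClosureProofs
import HarnessLib

/-!
# pnp.S06 corrected: the Mignon–Ressayre bound `n² ≤ 2 · dc(PER_n)` in characteristic `0`

Companion of `Literature/Computability/Complexity/PNPWave0.lean` (wave-0 statement **pnp.S06**,
the named fact `Literature.Computability.Complexity.sq_le_two_mul_determinantalComplexity_per`).

## Why a corrected statement (the wave-0 fact is mis-stated)

The wave-0 fact asserts: for EVERY field `F` with `ringChar F ≠ 2` and every `n ≥ 3`,
`n ^ 2 ≤ 2 * determinantalComplexity (per F n)`, citing "Mignon–Ressayre 2004, Theorem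
(characteristic 0)" and "Cai–Chen–Li 2010, Theorem 1 (characteristic ≠ 2)". Reading the sources:

* Mignon–Ressayre 2004 prove `dc(per_n) ≥ n²/2` over fields of characteristic `0` only
  (quoted verbatim in Cai–Chen–Li 2010, Thm. 2.2: "For any field of characteristic 0,
  `dc(per_n) ≥ n²/2`"; Landsberg 2017, Thm. 6.4.6.4).
* Cai–Chen–Li 2010 (comput. complex. 19, 37–56) do NOT prove `n²/2` for all `n` in odd
  characteristic. Their main result is Thm. 2.3: for a prime `p > 2`, (i) if `p ≠ 23`, for every
  `n > 2` with `p ∣ n + 1` there is an `(n+1) × (n+1)` matrix `X₀` over `𝔽_p` with `per X₀ = 0`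
  and `rank H(X₀) ≥ (n-2)(n-3)`; (ii) if `p ∉ {3, 5}`, the same for every `n > 1` with
  `p ∣ n + 2`; whence Cor. 2.4: "For every prime `p ≠ 2`, there exist infinitely many positive
  integers `n` such that `dc(per_n) ≥ (n-2)(n-3)/2` over a field of char `F = p`" (the printed
  proof gives this for `per_{n+1}`, the matrices of Thm. 2.3 being `(n+1) × (n+1)`). There is no
  "Theorem 1" with the content cited by the wave-0 docstring.

So the wave-0 fact over-claimed in positive characteristic (all `n ≥ 3`, constant exactly
`1/2`) relative to both of its sources; whether that is true is open as far as these sources go.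
The statement the sources DO establish is proved here:

* `sq_le_two_mul_determinantalComplexity_per_of_charZero` — over a field of characteristic `0`,
  `n ^ 2 ≤ 2 * determinantalComplexity (per F n)` for EVERY `n` (Mignon–Ressayre 2004, main
  Theorem; for `n ≤ 2` this is the degree bound `n = deg per_n ≤ dc(per_n)`), in the wave-0
  vocabulary `Literature.Computability.Complexity.per` / `.determinantalComplexity`;
* `sq_le_two_mul_determinantalComplexity_per_of_ringChar_eq_zero` — the same in the shape of
  the wave-0 fact (`ringChar F = 0`, `3 ≤ n`);
* `sq_le_two_mul_determinantalComplexity_per_holds` — **discharge** of the wave-0 fact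
  `sq_le_two_mul_determinantalComplexity_per`, which was RESTATED IN PLACE (2026-08-15, work item
  `wi-07998`: hypothesis `ringChar F ≠ 2` corrected to `ringChar F = 0`, exactly as its twin
  `Literature.Computability.AlgebraicComplexity.sq_le_two_mul_determinantalComplexity_perPoly` had
  been), so that the tier-0 cone of `Summits/PneNP` carries no unprovable debt.

Both are short consequences of the tree's PROVED theorem
`Literature.Computability.AlgebraicComplexity.sq_le_two_mul_of_hasDetRepr_perPoly`
(`MignonRessayreBound.lean`: the full Mignon–Ressayre argument — Hessian rank `≤ 2M` at a zero of
`det A`, the point `y₀ = J - n e₁₁`, non-degeneracy of the Hessian of `per_n` at `y₀` in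
characteristic `0`), of Valiant universality (`hasDetRepr_determinantalComplexity_holds`: the
infimum `dc` is attained), of the degree bound `n ≤ dc(per_n)`
(`le_determinantalComplexity_perPoly`), and of the `rfl` bridges `determinantalComplexity_eq`,
`perPoly_fin_eq` between the two vocabularies. The positive-characteristic statement of
Cai–Chen–Li (Thm. 2.3 / Cor. 2.4 above) is a different theorem and is not asserted here.

## References

* T. Mignon, N. Ressayre, *A quadratic bound for the determinant and permanent problem*,
  Int. Math. Res. Not. 2004, no. 79, 4241–4253, main Theorem (key `MignonRessayre2004`).
* J.-Y. Cai, X. Chen, D. Li, *Quadratic lower bound for permanent vs. determinant in any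
  characteristic*, comput. complex. 19 (2010) 37–56, Thm. 2.2 (quoting MR), Thm. 2.3, Cor. 2.4
  (key `CaiChenLi2010`).
* J. M. Landsberg, *Geometry and Complexity Theory*, CUP 2017, Thm. 6.4.6.4.
-/

namespace Literature.Computability.Complexity

/-- **pnp.S06, corrected to what the source proves (Mignon–Ressayre 2004, main Theorem;
quoted as Cai–Chen–Li 2010, Thm. 2.2 and Landsberg 2017, Thm. 6.4.6.4: "For any field of
characteristic 0, `dc(per_n) ≥ n²/2`").** Over a field `F` of characteristic `0`, for every `n`,
`n ^ 2 ≤ 2 * dc(PER_n)`. This replaces, in characteristic `0`, the mis-stated wave-0 fact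
`sq_le_two_mul_determinantalComplexity_per` (which claims the bound for all fields of
characteristic `≠ 2`; Cai–Chen–Li 2010, Thm. 2.3 / Cor. 2.4 only give
`(n-2)(n-3) ≤ 2 dc(per_{n+1})` for `p ∣ n + 1` or `p ∣ n + 2`). Proof: for `n ≥ 3` this is the
tree's theorem `sq_le_two_mul_of_hasDetRepr_perPoly` at the attained representation of size `dc`
(`hasDetRepr_determinantalComplexity_holds`); for `n ≤ 2`, `n² ≤ 2n` and `n ≤ dc(PER_n)`
(`le_determinantalComplexity_perPoly`, the degree bound). [cite: MignonRessayre2004, main Theorem] -/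
theorem sq_le_two_mul_determinantalComplexity_per_of_charZero (F : Type*) [Field F] [CharZero F]
    (n : ℕ) : n ^ 2 ≤ 2 * determinantalComplexity (per F n) := by
  -- the wave-0 `dc`/`per` are definitionally the prelude `determinantalComplexity`/`perPoly`
  change n ^ 2 ≤ 2 * Literature.Computability.AlgebraicComplexity.determinantalComplexity
    (Literature.Computability.AlgebraicComplexity.perPoly (Fin n) F)
  by_cases hn : 3 ≤ n
  · obtain ⟨m, rfl⟩ : ∃ m, n = m + 3 := ⟨n - 3, by omega⟩
    exact Literature.Computability.AlgebraicComplexity.sq_le_two_mul_of_hasDetRepr_perPoly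
      (Literature.Computability.AlgebraicComplexity.hasDetRepr_determinantalComplexity_holds _)
  · have hdeg := Literature.Computability.AlgebraicComplexity.le_determinantalComplexity_perPoly
      (k := F) n
    have h2 : n ^ 2 ≤ 2 * n := by
      interval_cases n <;> norm_num
    exact h2.trans (Nat.mul_le_mul_left 2 hdeg)

/-- The corrected bound in the exact shape of the wave-0 fact (hypothesis `ringChar F = 0` in
place of `ringChar F ≠ 2`, and `3 ≤ n`): Mignon–Ressayre 2004, main Theorem.
[cite: MignonRessayre2004, main Theorem] -/
theorem sq_le_two_mul_determinantalComplexity_per_of_ringChar_eq_zero {F : Type*} [Field F]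
    (hF : ringChar F = 0) {n : ℕ} (_hn : 3 ≤ n) :
    n ^ 2 ≤ 2 * determinantalComplexity (per F n) := by
  haveI : CharZero F := by
    haveI : CharP F 0 := ringChar.eq_iff.1 hF
    exact CharP.charP_to_charZero F
  exact sq_le_two_mul_determinantalComplexity_per_of_charZero F n

/-- The corrected bound in the prelude (`CplxAlg`) vocabulary, for every `n`: over a field of
characteristic `0`, `n ^ 2 ≤ 2 * dc(PER_n)` with `dc = Literature.Computability.AlgebraicComplexity.determinantalComplexity`
and `PER_n = perPoly (Fin n) k` (Mignon–Ressayre 2004, main Theorem). This is the characteristic-`0`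
replacement of the equally mis-stated characteristic-`≠ 2` twin
`Literature.Computability.AlgebraicComplexity.sq_le_two_mul_determinantalComplexity_perPoly`
(`PermanentVsDeterminant.lean`), and extends the tree's `sq_le_two_mul_of_hasDetRepr_perPoly`
(sizes `m + 3`) to all `n` by the degree bound. [cite: MignonRessayre2004, main Theorem] -/
theorem _root_.Literature.Computability.AlgebraicComplexity.sq_le_two_mul_determinantalComplexity_perPoly_of_charZero
    (k : Type*) [Field k] [CharZero k] (n : ℕ) :
    n ^ 2 ≤ 2 * Literature.Computability.AlgebraicComplexity.determinantalComplexity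
      (Literature.Computability.AlgebraicComplexity.perPoly (Fin n) k) :=
  sq_le_two_mul_determinantalComplexity_per_of_charZero k n

/-- **Discharge of pnp.S06** (`sq_le_two_mul_determinantalComplexity_per`, `PNPWave0.lean`, as
restated 2026-08-15 to characteristic `0`; Mignon–Ressayre 2004, main Theorem): over a field `F`
with `ringChar F = 0` and for `n ≥ 3`, `n ^ 2 ≤ 2 · dc(PER_n)` — the theorem
`sq_le_two_mul_determinantalComplexity_per_of_ringChar_eq_zero` above, i.e. the tree's proof of the
Mignon–Ressayre bound (`MignonRessayreBound.lean`). The proof lives here rather than next to the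
fact because the Hessian argument imports `PNPWave0.lean` (through `PermanentVsDeterminant.lean`).
[cite: MignonRessayre2004, main Theorem] -/
theorem sq_le_two_mul_determinantalComplexity_per_holds :
    sq_le_two_mul_determinantalComplexity_per := by
  intro F _ hF n hn
  exact sq_le_two_mul_determinantalComplexity_per_of_ringChar_eq_zero hF hn

end Literature.Computability.Complexity
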